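/-
Copyright (c) 2026. All rights reserved.
Released under Apache 2.0 license as described in the file LICENSE.
Authors: abc-iut cell, seat abc-iut-f-069 (gen 3; Prop 1.3 at constructed data — bundle, second instalment).
-/
import Literature.AnabelianGeometry.AbsoluteAnabelian.AbsTopII.DPSCIndexDataOfOuterActionBundle
import Literature.AnabelianGeometry.AbsoluteAnabelian.AbsTopII.DPSCDataOfOuterActionNodeProduct
import Literature.AnabelianGeometry.AbsoluteAnabelian.AbsTopII.DPSCDataOfOuterActionNondegenerateIff

/-!
# [AbsTopII] Prop 1.3 at `Π_𝒢 ⋊^out_θ J` — bundle, second instalment (adds (ii) and (viii) first clause)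

S. Mochizuki, *Topics in Absolute Anabelian Geometry II* [AbsTopII] (bib `MochizukiAbsTopII2013`), §1
Prop 1.3 p. 11; [CombGC] (bib `MochizukiCombGC2007`) Prop 1.2 p. 8, Rmk 1.1.3.

PROOF-ONLY (no definition).  `prop13_bundle_ofOuterAction` (p447072) conjoined Prop 1.3 (i), (iii), (iii)′,
(iii)″, (v), (v)′, (vi), (vii), (ix) AS TYPED at the DPSC-extension of construction data `(G, J, θ, I)`.  This
file adds, under ONE further Rmk 1.1.3 hypothesis (node groups `≅ Ẑ^Σ`), the node clauses since landed:
Prop 1.3 (ii) "`1 → Π_e → I_e → I → 1` exact" in its three typed clauses `Π_e ⊆ I_e`, `I_e ∩ Π_𝔾 = Π_e`,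
`I_e · Π_𝔾 = Π_I` (p448370 `IvNode_exact_ofOuterAction_of_dehn`, whose first clause is also the first
clause of (viii)), and (ii) "`I_e ≅ Ẑ^Σ × Ẑ^Σ`" as typed (p449711 `IvNode_isInternalProduct_ofOuterAction_of_dehn`).
NOT included (and why): the branch-pair clause of (ii)/(ii)′ (the index `i^Σ_e` is the `Σ`-index DATUM `σ`,
a free parameter of `DPSCIndexData.ofOuterAction`); (iv), (iv)′, (viii) second clause (their constructed-data
forms are the faithfulness / dichotomy INPUTS — see `DPSCData.nondegenerate_iff`, p447322, and
`prop_1_3_viii'_ofOuterAction_of_dehn`, p448370); §2 restates the faithfulness dictionary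
`DPSCData.nondegenerate_iff` with its three datum-level inputs DISCHARGED from `(G, J, θ, I)`-hypotheses
(graphic lifts, [CombGC] Prop 1.2 (i)(ii), slim `Π_v`, Π_v-fixing lifts), so that it, too, is quotable
from construction data alone.  HONEST FRAMING: typed ≠ proved for the named inputs
(F-0438, F-0459, graphicity and Π_v-fixing of lifts are hypotheses); nothing here bears on [IUTchIII]
Cor 3.12 or takes a side on any author.
-/

noncomputable section

open scoped Pointwise

namespace Literature.AnabelianGeometry.AbsoluteAnabelian

open Literature.AlgebraicGeometry.Frobenioids (IsSlimGroup)
open Literature.AnabelianGeometry.EtaleTheta (contMulAut mem_contMulAut TopOut)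
open Literature.AnabelianGeometry.SemiGraphs
open Literature.AnabelianGeometry.Anabelioids (IsSigmaInteger)
open Topology

universe u

namespace AbsTopII.DPSCIndexData

section OuterAction

variable {P : Type u} [Group P] [TopologicalSpace P] [IsTopologicalGroup P] [CompactSpace P]
  [TotallyDisconnectedSpace P] (G : PSCDatum P) (hG : IsTopologicallyFinitelyGenerated P)
  (hZ : Subgroup.center P = ⊥)
  {J : Type u} [Group J] [TopologicalSpace J] [IsTopologicalGroup J] [CompactSpace J]
  [TotallyDisconnectedSpace J] (θ : J →ₜ* outProfinite hG) (I : Subgroup J) [I.Normal]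
  (σ : G.graph.N → ℕ) (hσ : ∀ e, IsSigmaInteger G.Sigma (σ e))

include hZ

/-- **[AbsTopII] Prop 1.3 (i), (ii) [exact sequence; `I_e ≅ Ẑ^Σ × Ẑ^Σ`], (iii), (iii)′, (iii)″, (v), (v)′,
(vi), (vii), (viii) [first clause], (ix) AS TYPED, TOGETHER, at the DPSC-extension `Π_𝒢 ⋊^out_θ J` of
construction data, from hypotheses on `(G, J, θ, I)` ONLY.** [cite: MochizukiAbsTopII2013, Prop 1.3 p.11]
[cite: MochizukiCombGC2007, Prop 1.2 p.8] -/
theorem prop13_bundle₂_ofOuterAction [Nontrivial P] (hslim : IsSlimGroup P)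
    (hθ : ∀ j : J, ∃ φ : P ≃ₜ* P,
      TopOut.mk P ⟨φ.toMulEquiv, (mem_contMulAut P).mpr ⟨φ.continuous, φ.symm.continuous⟩⟩ =
        outerActionOfContinuous hG θ j ∧ G.IsGraphic G φ)
    (hCT : G.VerticialEdgeLikeCommensurablyTerminal) (hDetV : G.VerticialOpenInterDeterminesVertex)
    (hDet : G.EdgeLikeOpenInterDeterminesEdge)
    (hslimv : ∀ w, IsSlimGroup ↥(G.vertGp w))
    (hnab : ∀ (e : G.graph.N), ∀ x ∈ G.nodeGp e, ∀ y ∈ G.nodeGp e, x * y = y * x)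
    (hncyc : ∀ e : G.graph.N, IsFreeProSigmaCyclic G.Sigma ↥(G.nodeGp e))
    (hcab : ∀ (c : G.graph.C), ∀ x ∈ G.cuspGp c, ∀ y ∈ G.cuspGp c, x * y = y * x)
    (hccyc : ∀ c : G.graph.C, IsFreeProSigmaCyclic G.Sigma ↥(G.cuspGp c))
    (hDehn : ∀ (v : G.graph.V) (i : J), i ∈ I → ∃ φ : P ≃ₜ* P,
      TopOut.mk P ⟨φ.toMulEquiv, (mem_contMulAut P).mpr ⟨φ.continuous, φ.symm.continuous⟩⟩ =
        outerActionOfContinuous hG θ i ∧ ∀ x ∈ G.vertGp v, φ x = x)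
    (hND : ∀ i ∈ I, i ≠ 1 → ∀ (v v' : G.graph.V) (γ : ConjAct P),
      (∃ φ : P ≃ₜ* P,
        TopOut.mk P ⟨φ.toMulEquiv, (mem_contMulAut P).mpr ⟨φ.continuous, φ.symm.continuous⟩⟩ =
          outerActionOfContinuous hG θ i ∧ (∀ x ∈ G.vertGp v, φ x = x) ∧ ∀ x ∈ γ • G.vertGp v', φ x = x) →
      γ • G.vertGp v' = G.vertGp v)
    (hIc : IsClosed (I : Set J)) (hI : IsFreeProSigmaCyclic G.Sigma ↥I) :
    (Literature.AnabelianGeometry.AbsoluteAnabelian.AbsTopII.DPSCIndexData.Prop_1_3_i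
        (ofOuterAction G hG θ I σ hσ) ∧
      (DPSCData.ofOuterAction G hG θ I).Prop13iii ∧
      Literature.AnabelianGeometry.AbsoluteAnabelian.AbsTopII.DPSCIndexData.Prop_1_3_iii'
        (ofOuterAction G hG θ I σ hσ) ∧
      Literature.AnabelianGeometry.AbsoluteAnabelian.AbsTopII.DPSCIndexData.Prop_1_3_iii''
        (ofOuterAction G hG θ I σ hσ) ∧
      (DPSCData.ofOuterAction G hG θ I).Prop13v ∧
      Literature.AnabelianGeometry.AbsoluteAnabelian.AbsTopII.DPSCIndexData.Prop_1_3_v'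
        (ofOuterAction G hG θ I σ hσ) ∧
      (DPSCData.ofOuterAction G hG θ I).Prop13vi ∧
      (DPSCData.ofOuterAction G hG θ I).Prop13vii ∧
      (DPSCData.ofOuterAction G hG θ I).Prop13ix) ∧
    (∀ n : (DPSCData.ofOuterAction G hG θ I).Node,
      (DPSCData.ofOuterAction G hG θ I).nodeSub n ≤ (DPSCData.ofOuterAction G hG θ I).IvNode n ∧
      (DPSCData.ofOuterAction G hG θ I).IvNode n ⊓ (DPSCData.ofOuterAction G hG θ I).PiG =
        (DPSCData.ofOuterAction G hG θ I).nodeSub n ∧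
      (DPSCData.ofOuterAction G hG θ I).IvNode n ⊔ (DPSCData.ofOuterAction G hG θ I).PiG =
        (DPSCData.ofOuterAction G hG θ I).PiI) ∧
    (∀ n : (DPSCData.ofOuterAction G hG θ I).Node,
      ∃ A B : Subgroup (DPSCData.ofOuterAction G hG θ I).PiH,
        IsClosed (A : Set (DPSCData.ofOuterAction G hG θ I).PiH) ∧
        IsClosed (B : Set (DPSCData.ofOuterAction G hG θ I).PiH) ∧
        IsFreeProSigmaCyclic G.Sigma ↥A ∧ IsFreeProSigmaCyclic G.Sigma ↥B ∧
        AbsTopII.IsInternalProduct A B ((DPSCData.ofOuterAction G hG θ I).IvNode n)) :=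
  ⟨prop13_bundle_ofOuterAction G hG hZ θ I σ hσ hslim hθ hCT hDetV hDet hslimv hnab hcab hccyc hDehn hND
      hIc hI,
    DPSCData.IvNode_exact_ofOuterAction_of_dehn G hG hZ θ I hCT hnab hDehn,
    DPSCData.IvNode_isInternalProduct_ofOuterAction_of_dehn G hG hZ θ I hCT hslimv hnab hncyc hDehn hIc hI⟩

end OuterAction

end AbsTopII.DPSCIndexData

/-! ## §2. The faithfulness dictionary from construction-data hypotheses only -/

namespace DPSCData

section OuterAction

variable {P : Type u} [Group P] [TopologicalSpace P] [IsTopologicalGroup P] [CompactSpace P]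
  [TotallyDisconnectedSpace P] (G : PSCDatum P) (hG : IsTopologicallyFinitelyGenerated P)
  (hZ : Subgroup.center P = ⊥)
  {J : Type u} [Group J] [TopologicalSpace J] [IsTopologicalGroup J] [CompactSpace J]
  [TotallyDisconnectedSpace J] (θ : J →ₜ* outProfinite hG) (I : Subgroup J) [I.Normal]

include hZ in
/-- **Non-degeneracy of `ρ_I` ⟺ (Prop 1.3 (iv)′₂ ∧ input (L)) at `Π_𝒢 ⋊^out_θ J`, from construction-data
hypotheses only**: `DPSCData.nondegenerate_iff` (p447322) with its datum-level inputs — graphicity of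
`conjAutOf`, `I_v ∩ Π_𝔾 = {1}`, and the finite-index vertex-determination `hDetv` — discharged from graphic
lifts of `θ`, [CombGC] Prop 1.2 (ii) + slim `Π_v` + Π_v-fixing lifts (Prop 1.3 (iii)), and [CombGC]
Prop 1.2 (i) read through the presentation of the embedded datum.
[cite: MochizukiAbsTopII2013, Prop 1.3 (iv) p.12] [cite: MochizukiCombGC2007, Prop 1.2 p.8] -/
theorem nondegenerate_iff_of_lifts
    (hθ : ∀ j : J, ∃ φ : P ≃ₜ* P,
      TopOut.mk P ⟨φ.toMulEquiv, (mem_contMulAut P).mpr ⟨φ.continuous, φ.symm.continuous⟩⟩ =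
        outerActionOfContinuous hG θ j ∧ G.IsGraphic G φ)
    (hCT : G.VerticialEdgeLikeCommensurablyTerminal) (hDetV : G.VerticialOpenInterDeterminesVertex)
    (hslimv : ∀ w, IsSlimGroup ↥(G.vertGp w))
    (hDehn : ∀ (v : G.graph.V) (i : J), i ∈ I → ∃ φ : P ≃ₜ* P,
      TopOut.mk P ⟨φ.toMulEquiv, (mem_contMulAut P).mpr ⟨φ.continuous, φ.symm.continuous⟩⟩ =
        outerActionOfContinuous hG θ i ∧ ∀ x ∈ G.vertGp v, φ x = x) :
    (∀ i ∈ I, i ≠ 1 → ∀ (v v' : G.graph.V) (γ : ConjAct P),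
      (∃ φ : P ≃ₜ* P,
        TopOut.mk P ⟨φ.toMulEquiv, (mem_contMulAut P).mpr ⟨φ.continuous, φ.symm.continuous⟩⟩ =
          outerActionOfContinuous hG θ i ∧ (∀ x ∈ G.vertGp v, φ x = x) ∧ ∀ x ∈ γ • G.vertGp v', φ x = x) →
      γ • G.vertGp v' = G.vertGp v) ↔
    ((∀ (v v' : (ofOuterAction G hG θ I).Vert) (γ : (ofOuterAction G hG θ I).PiH),
        γ ∈ (ofOuterAction G hG θ I).PiG →
          (ofOuterAction G hG θ I).Iv v ⊓ MulAut.conj γ • (ofOuterAction G hG θ I).Iv v' ≠ ⊥ → v = v') ∧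
      ∀ (v : (ofOuterAction G hG θ I).Vert) (g : (ofOuterAction G hG θ I).PiH),
        (ofOuterAction G hG θ I).Iv v ⊓ MulAut.conj g • (ofOuterAction G hG θ I).Iv v ≠ ⊥ →
          MulAut.conj g • (ofOuterAction G hG θ I).vertSub v = (ofOuterAction G hG θ I).vertSub v) := by
  -- [CombGC] Prop 1.2 (i), finite-index form, through the presentation of the embedded datum
  obtain ⟨e, he⟩ := exists_rangeEquiv G _ _ (isClosed_range_inlProfinite hG θ) (range_inlProfinite_normal hG θ)
    (I.comap (sndProfinite hG θ).toMonoidHom) inferInstance (range_inl_le_comap_snd hG θ I)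
    (inlProfinite hG θ).continuous (inlProfinite_injective hG θ hZ)
  have hDetv := (ofOuterAction G hG θ I).vertDet_of_psc
    (G.mapAlong e.toMulEquiv.toMonoidHom e.continuous G.Sigma subset_rfl G.sigma_nonempty
      (G.proSigma.of_continuousMulEquiv e))
    Equiv.ulift (vertSub_presentation G _ _ _ _ _ _ _ he)
    ((PSCDatum.verticialOpenInterDeterminesVertex_mapAlong_equiv_iff G e _ _ _ _).mpr hDetV)
  exact nondegenerate_iff G hG hZ θ I (isGraphic_conjAutOf_of_lifts G hG θ hθ)
    (fun v => (prop13iii_ofOuterAction_of_fixing_lifts G hG hZ θ I hCT hslimv hDehn v).1) hDetv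

end OuterAction

end DPSCData

end Literature.AnabelianGeometry.AbsoluteAnabelian

end
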